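import Summits.QuantumFields.BalabanUV.Beta.GAN24.DirichletBoxCompression
import Summits.QuantumFields.BalabanUV.T4Continuum.Support.PerturbationAlgebra

/-!
# T⁴ programme, spine node NE2 (U1a), sub-row Δ1 «NE2⁰-Dirichlet» (T4-DAG `T4-U1a.S-NE2-D1-DIRICHLET°`) — THE Ω-RESTRICTED SCALAR
# FREE TOWER AT `U = 1`: [B9] (3.24)'s `Δ′_a↾Ω₀ = Ω₀(−Δ + aQ′*Q′)Ω₀` at `U = 1` (King's scalar model, ONE region, ONE averaging scale)
# along the tower `n_k = L^k`, in the lineage's `FreeTowerLaws` shape, with every field PROVED except the injected two-level law,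
# which is DISPLAYED as the one missing inequality `hinjS` — LITERALLY the target of the road-P2 Dirichlet-box END

Twelfth generation of the NE2 prover lineage P1 of the cell `pub-balaban` (row NE2 owner), file 2 (owner item O12-b, INTENT journal
2026-08-20 l.14713).  [Balaban1985BackgroundPropagators] p. 394 prints «Let us introduce the operator Δ′_a = Δ′_a(U) = (Δ^η_U + Q′*aQ′)↾Ω₀
… the operator Δ′_a with Dirichlet boundary conditions on ∂Ω₀, i.e. the operator Δ′_a↾Ω₀ = Ω₀Δ′_aΩ₀ … Its inverse is denoted by G′» ((3.24);
the gauge projection (3.25) and the vector operator (3.26)–(3.27) are BUILT FROM this G′).  At `U = 1`, for ONE region and ONE averaging scale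
(no `{Λ_j, a_j}`), `Δ′_a` is EXACTLY King's scalar model `Δ′ = −Δ + a′·Π′` (`ScalarAveragedPropagator.DeltaPs`, row B4.c) and its compression
to `ℓ²(Ω)` (zero OUTSIDE) is road P2's `DirichletBoxCompression.DOm n M a′ Ω = (DeltaPs n M a′).toBlock Ω Ω` (unit b2b-balaban-gan24-p2, supplier
item «Δ1-BOX-SCALAR» under this sub-row, ruling R20 (c)).  The lineage's earlier Δ1 files (`DirichletRegionTower`, `DirichletFreeTower`) type
the VECTOR tower `(Δ_a^{(k)})_{ΩΩ}` — a MODEL of (3.27) compressing the torus gauge projection (located delta G-ne2p1-g12-1).  THIS FILE types the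
SCALAR region tower — faithful to (3.24) at `U = 1` — on road P2's carriers BY NAME:
 * §1 THE REGION TOWER: from a decidable predicate `Ω₀` on the unit lattice the level-`k` regions `regS Ω₀ k` (iterated `refineR`: a fine site
   is inside iff its block parent is), index types `sidx Ω₀ k`, compressed objects `DsR k = DOm (lev L k) M a′ (regS Ω₀ k)`, `QsR k` (King's
   0-form block averaging `Q0lev` compressed), `JsR k = JOm (lev L k) L M (regS Ω₀ k)`.
 * §2 COMPATIBILITY: `Q₀`/`J₀` never couple the region to its complement (compression is multiplicative, `SubtypeCompression.toBlock_mul_of_vanish_*`).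
 * §3 THE TRANSFERRED FIELDS: `‖QsR k‖² ≤ L^{−d}`, `‖JsR k‖ ≤ 1`, EXACT pairing `√(L^d)·QsR k·JsR k = 1`, invertibility and **`‖(DsR k)⁻¹‖ ≤ γ′⁻¹`**
   uniformly (road P2's `opNorm_inv_DOm_le`), and the COMPLEMENT LAW **`complement_le_S`**: `‖(DsR (k+1))⁻¹·(1 − J_kJ_kᴴ)_{Ω′Ω′}‖ ≤ 2d√(γ′⁻¹)·L^{−k}`
   — the 0-form block Poincaré inequality `ScalarBlockPlanting.opNorm_one_sub_Pi0_mul_le` on the zero-extended Dirichlet solution operator,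
   lattice gradients bounded through the coercive form (road P2's `nsq_sdiff_solExt_le`); no Fourier analysis.
 * §4 THE END **`freeTowerLaws_dirichletScalar_of_injected`**: `FreeTowerLaws (DsR Ω₀) (QsR Ω₀) (JsR Ω₀) 0 L^d (2d√(γ′⁻¹)·L^{−k}) e₁ 0` from ONE
   displayed binder `hinjS : ∀ k, ‖(DsR (k+1))⁻¹·JsR k − JsR k·(DsR k)⁻¹‖ ≤ e₁ k`, which UNFOLDS DEFINITIONALLY to road P2's two-level target
   `‖(DOm (L·n_k) M a′ (refineR n_k L M Ω_k))⁻¹·JOm … − JOm … ·(DOm n_k M a′ Ω_k)⁻¹‖ ≤ e₁ k` at `(N, R) = (L^k, L)` (kernel `example`); then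
   **`towerLimitRate_dirichletScalar_of_injected`** / **`_perturbed`** at any geometric rate `θ ∈ [L⁻¹, 1)`.

WHY `hinjS` IS DISPLAYED, AND WHAT CLOSES IT (owner's census `t4/T4-EST-NE2-P1.md` §G11.0 (C), §G12).  On the torus the injected law is
`EffectiveLaplacianExcess.freeTowerLaws_king_scalar` (Fourier symbols).  A region has no translation invariance; road P2 (`Beta/GAN24/DirichletBox*`)
proves the law in real space (pairing identity M-P, window bound M-PB, discrete `H²` on CORNER-FREE regions M-R, compression M-C; the two-level
END M-E for boxes is their next file; general unions of cubes conditional on one `DiscreteH2` binder there); the numerical census (leaf-07-g4,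
Δ1-INJ) sees the torus rate `L^{−k}` in every geometry tried (d ≤ 4).  When M-E lands, `hinjS` is discharged for coordinate-product `Ω₀` by
`exact` — v1.1 of this file.  Nothing here asserts `hinjS`.

HONEST FRAMING (T4-DAG p. 1).  `U = 1`; SCALAR layer ((3.24)'s `G′`, not the vector `G` of (3.27)); ONE region, ONE averaging scale; finite
torus; linear layer; operator norm; statements, pairing and constants OURS ([folklore] over landed modules; `[cite:]` tags locate SHAPES);
NE2 (U1a) NOT proved; spine 0/9 unchanged; NOT infinite volume, NOT a mass gap, NOT the Clay problem, NOT summit progress.  HONEST DEPENDENCY: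
continuum YM on T⁴ ⇐ BetaPertH ∧ nine spine estimates (0/9 proved); BetaPertH ⇐ (D1) ∧ (D4) ∧ CAP+tail; G-an2-4 gates asym, D1 and NE2/3/4.
No `sorry`.
-/

noncomputable section

open scoped BigOperators ComplexConjugate Matrix Matrix.Norms.L2Operator
open Filter Topology

namespace Summit.QuantumFields.BalabanUV.T4Continuum.DirichletScalarTower

open Literature.MathematicalPhysics.QuantumFieldTheory.Balaban1983to89.B5Prop11Plancherel (Tor fine opNorm_le_of_sq_le)
open Literature.MathematicalPhysics.QuantumFieldTheory.Balaban1983to89.B5Action121 (shiftS sdiff)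
open Literature.MathematicalPhysics.QuantumFieldTheory.Balaban1983to89.B5Prop11Lower (nsq nsq_nonneg nsq_mulVec_le)
open Literature.MathematicalPhysics.QuantumFieldTheory.Balaban1983to89.B5G183RateUnitTower (lev lev_neZero)
open Summit.QuantumFields.BalabanUV.T4Continuum
open Summit.QuantumFields.BalabanUV.T4Continuum.CovariantAveragingTower (TowerLimitRate)
open Summit.QuantumFields.BalabanUV.T4Continuum.BalabanAveragedTowerUnit (one_le_lev' cast_lev')
open Summit.QuantumFields.BalabanUV.T4Continuum.BalabanAveragedTowerModes (par)
open Summit.QuantumFields.BalabanUV.T4Continuum.BackgroundResolventTower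
open Summit.QuantumFields.BalabanUV.T4Continuum.SubtypeCompression
open Summit.QuantumFields.BalabanUV.T4Continuum.ScalarBlockPlanting (Qavg0 JK0 Pi0 JK0_mul_conjTranspose Pi0_conjTranspose
  opNorm_one_sub_Pi0_mul_le)
open Summit.QuantumFields.BalabanUV.T4Continuum.ScalarPlantingDefect (Q0lev J0pcT opNorm_J0pcT_le opNorm_Q0lev_sq_le
  sqrt_smul_Q0lev_mul_J0pcT opNorm_shiftS_sub_one_mul_le)
open Summit.QuantumFields.BalabanUV.T4Continuum.ScalarAveragedPropagator (DeltaPs gammaPs gammaPs_pos opNorm_le_of_nsq_le_rect)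
open Summit.QuantumFields.BalabanUV.T4Continuum.PerturbationAlgebra (perturbationLaws_zero)
open Summit.QuantumFields.BalabanUV.Beta.GAN24.DirichletBoxCompression (DOm isUnit_det_DOm opNorm_inv_DOm_le DOm_isHermitian
  inv_DOm_isHermitian solExt nsq_sdiff_solExt_le refineR JOm JK0_vanish_left JK0_vanish_right)

variable {d : ℕ} (L : ℕ) [NeZero L] (M : Fin d → ℕ) [hM : ∀ μ, NeZero (M μ)]

/-! ## §1 The region tower generated by a unit-lattice predicate, and the compressed scalar objects -/

/-- MEMBERSHIP AT LEVEL `k` in the region generated by the unit-lattice predicate `Ω₀` (scalar sites): iterated road-P2 refinement —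
a level-`(k+1)` site belongs iff its block parent at level `k` does, i.e. iff its unit block lies in `Ω₀`.  (ONE region, no sequence
`{Ω_j}`.) [cite: Balaban1985BackgroundPropagators, p.394 (3.24) (shape: Ω₀ a union of blocks)] [folklore] -/
def regS (Ω₀ : Tor (fine (lev L 0) M) → Prop) : (k : ℕ) → (Tor (fine (lev L k) M) → Prop)
  | 0 => Ω₀
  | k + 1 => refineR (lev L k) L M (regS Ω₀ k)

/-- decidability of region membership, level by level. [folklore] -/
instance decRegS (Ω₀ : Tor (fine (lev L 0) M) → Prop) [DecidablePred Ω₀] : (k : ℕ) → DecidablePred (regS L M Ω₀ k)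
  | 0 => inferInstanceAs (DecidablePred Ω₀)
  | k + 1 => fun y => decRegS Ω₀ k (par (lev L k) L M y)

omit [NeZero L] hM in
/-- the recursion, as an `iff`. [folklore] -/
theorem regS_succ (Ω₀ : Tor (fine (lev L 0) M) → Prop) (k : ℕ) (y : Tor (fine (lev L (k + 1)) M)) :
    regS L M Ω₀ (k + 1) y ↔ regS L M Ω₀ k (par (lev L k) L M y) := Iff.rfl

/-- the INDEX TYPES of the scalar region tower: the level-`k` sites inside the region. [folklore] -/
abbrev sidx (Ω₀ : Tor (fine (lev L 0) M) → Prop) [DecidablePred Ω₀] (k : ℕ) : Type := {x : Tor (fine (lev L k) M) // regS L M Ω₀ k x}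

/-- the one-step block-mean projector `Π₀ = J₀J₀ᴴ` TYPED on the tower index (row B4.d's `Pi0 (lev L k) L M`, whose index `Tor (fine (L·n_k) M)`
is definitionally the level-`(k+1)` index `Tor (fine n_{k+1} M)`). [folklore] -/
def Pi0T (k : ℕ) : Matrix (Tor (fine (lev L (k + 1)) M)) (Tor (fine (lev L (k + 1)) M)) ℂ := Pi0 (lev L k) L M

/-- `Pi0T k` is the row-B4.d projector (definitional). [folklore] -/
theorem Pi0T_eq (k : ℕ) : Pi0T L M k = Pi0 (lev L k) L M := rfl

/-- `J₀J₀ᴴ = Π₀` on the tower index. [cite: King1986, (2.10) p.653] [folklore] -/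
theorem J0pcT_mul_conjTranspose (k : ℕ) : J0pcT L M k * (J0pcT L M k)ᴴ = Pi0T L M k := JK0_mul_conjTranspose (lev L k) L M

/-- `Π₀ᴴ = Π₀` on the tower index. [folklore] -/
theorem Pi0T_conjTranspose (k : ℕ) : (Pi0T L M k)ᴴ = Pi0T L M k := Pi0_conjTranspose (lev L k) L M

variable (a' : ℝ) (Ω₀ : Tor (fine (lev L 0) M) → Prop) [DecidablePred Ω₀]

/-- **THE Ω-RESTRICTED SCALAR FREE OPERATOR** `(Δ′^{(k)})_{ΩΩ} = Ω₀Δ′_aΩ₀` at level `k` — road P2's `DOm` BY NAME.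
[cite: Balaban1985BackgroundPropagators, p.394 (3.24)] [folklore] -/
def DsR (k : ℕ) : Matrix (sidx L M Ω₀ k) (sidx L M Ω₀ k) ℂ := DOm (lev L k) M a' (regS L M Ω₀ k)

/-- King's one-step 0-form block averaging restricted to the region. [cite: King1986, (2.10) p.653 (shape)] [folklore] -/
def QsR (k : ℕ) : Matrix (sidx L M Ω₀ k) (sidx L M Ω₀ (k + 1)) ℂ :=
  (Q0lev L M k).toBlock (regS L M Ω₀ k) (regS L M Ω₀ (k + 1))

/-- King's 0-form planting restricted to the region — road P2's `JOm` BY NAME. [cite: King1986, p.664 (convention before Prop. 3.8)] [folklore] -/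
def JsR (k : ℕ) : Matrix (sidx L M Ω₀ (k + 1)) (sidx L M Ω₀ k) ℂ := JOm (lev L k) L M (regS L M Ω₀ k)

omit [NeZero L] hM in
/-- `JsR` is the compressed tower planting (definitional). [folklore] -/
theorem JsR_eq (k : ℕ) : JsR L M Ω₀ k = (J0pcT L M k).toBlock (regS L M Ω₀ (k + 1)) (regS L M Ω₀ k) := rfl

/-! ## §2 Compatibility: averaging and planting never couple the region to its complement -/

omit [NeZero L] hM [DecidablePred Ω₀] in
/-- `Q₀` does not couple region rows to non-region columns. [folklore] -/
theorem Q0lev_vanish₁ (k : ℕ) : ∀ (i : Tor (fine (lev L k) M)) (y : Tor (fine (lev L (k + 1)) M)),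
    regS L M Ω₀ k i → ¬ regS L M Ω₀ (k + 1) y → Q0lev L M k i y = 0 := by
  intro i y hi hy
  by_cases h : par (lev L k) L M y = i
  · exact absurd ((regS_succ L M Ω₀ k y).mpr (h ▸ hi)) hy
  · show Qavg0 (lev L k) L M i y = 0
    rw [Qavg0, if_neg h]

omit [NeZero L] hM [DecidablePred Ω₀] in
/-- `J₀` does not couple region rows to non-region columns. [folklore] -/
theorem J0pcT_vanish₁ (k : ℕ) : ∀ (y : Tor (fine (lev L (k + 1)) M)) (i : Tor (fine (lev L k) M)),
    regS L M Ω₀ (k + 1) y → ¬ regS L M Ω₀ k i → J0pcT L M k y i = 0 :=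
  JK0_vanish_left (lev L k) L M (regS L M Ω₀ k)

omit [NeZero L] hM [DecidablePred Ω₀] in
/-- `J₀` does not couple non-region rows to region columns. [folklore] -/
theorem J0pcT_vanish₂ (k : ℕ) : ∀ (y : Tor (fine (lev L (k + 1)) M)) (i : Tor (fine (lev L k) M)),
    ¬ regS L M Ω₀ (k + 1) y → regS L M Ω₀ k i → J0pcT L M k y i = 0 :=
  JK0_vanish_right (lev L k) L M (regS L M Ω₀ k)

/-! ## §3 The transferred fields of `FreeTowerLaws` -/

/-- `‖QsR k‖² ≤ L^{−d}`. [folklore] -/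
theorem opNorm_QsR_sq_le (k : ℕ) : ‖QsR L M Ω₀ k‖ ^ 2 ≤ ((L : ℝ) ^ d)⁻¹ :=
  (pow_le_pow_left₀ (norm_nonneg _) (opNorm_toBlock_le _ _ _) 2).trans (opNorm_Q0lev_sq_le L M k)

/-- `‖JsR k‖ ≤ 1`. [folklore] -/
theorem opNorm_JsR_le (k : ℕ) : ‖JsR L M Ω₀ k‖ ≤ 1 :=
  (opNorm_toBlock_le _ _ _).trans (opNorm_J0pcT_le L M k)

/-- compression is multiplicative on `Q₀·J₀`. [folklore] -/
theorem QsR_mul_JsR (k : ℕ) :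
    QsR L M Ω₀ k * JsR L M Ω₀ k = (Q0lev L M k * J0pcT L M k).toBlock (regS L M Ω₀ k) (regS L M Ω₀ k) :=
  (toBlock_mul_of_vanish_left _ _ _ _ _ (Q0lev_vanish₁ L M Ω₀ k)).symm

/-- **THE EXACT PAIRING SURVIVES**: `√(L^d)·QsR k·JsR k = 1 + 0`. [cite: King1986, (2.10) p.653] [folklore] -/
theorem sqrt_smul_QsR_mul_JsR (k : ℕ) :
    ((((Real.sqrt ((L : ℝ) ^ d)) : ℝ) : ℂ)) • (QsR L M Ω₀ k * JsR L M Ω₀ k) = 1 + 0 := by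
  rw [QsR_mul_JsR, ← toBlock_smul, sqrt_smul_Q0lev_mul_J0pcT, add_zero, toBlock_one, add_zero]

/-- **`(Δ′^{(k)})_{ΩΩ}` IS INVERTIBLE** («G′(Ω) exists») — road P2 BY NAME. [cite: Balaban1985BackgroundPropagators, p.394 (3.24)] [folklore] -/
theorem isUnit_det_DsR (ha' : 0 < a') (k : ℕ) : IsUnit (DsR L M a' Ω₀ k).det :=
  isUnit_det_DOm (lev L k) M a' (regS L M Ω₀ k) ha'

/-- **`‖G′(Ω)‖ ≤ γ′⁻¹`** uniformly in the level and the region — road P2 BY NAME. [folklore] -/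
theorem opNorm_inv_DsR_le (ha' : 0 < a') (k : ℕ) : ‖(DsR L M a' Ω₀ k)⁻¹‖ ≤ (gammaPs d a')⁻¹ :=
  opNorm_inv_DOm_le (lev L k) M a' (regS L M Ω₀ k) ha'

/-- `(Δ′^{(k)})_{ΩΩ}` is Hermitian. [folklore] -/
theorem DsR_isHermitian (k : ℕ) : (DsR L M a' Ω₀ k).IsHermitian := DOm_isHermitian (lev L k) M a' (regS L M Ω₀ k)

section Complement

variable (k : ℕ)

/-- `J_kJ_kᴴ` compressed is the compressed block-mean projector `(Π₀)_{Ω′Ω′}`. [folklore] -/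
theorem JsR_mul_conjTranspose :
    JsR L M Ω₀ k * (JsR L M Ω₀ k)ᴴ = (Pi0T L M k).toBlock (regS L M Ω₀ (k + 1)) (regS L M Ω₀ (k + 1)) := by
  rw [JsR_eq, toBlock_conjTranspose, ← toBlock_mul_of_vanish_left _ _ _ _ _ (J0pcT_vanish₁ L M Ω₀ k), J0pcT_mul_conjTranspose]

/-- `1 − Π₀` does not couple the region to its complement (left form). [folklore] -/
theorem one_sub_Pi0_vanish₁ : ∀ (y z : Tor (fine (lev L (k + 1)) M)),
    regS L M Ω₀ (k + 1) y → ¬ regS L M Ω₀ (k + 1) z → (1 - Pi0T L M k) y z = 0 := by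
  intro y z hy hz
  have hne : y ≠ z := fun h => hz (h ▸ hy)
  rw [Matrix.sub_apply, Matrix.one_apply_ne hne, zero_sub, neg_eq_zero, ← J0pcT_mul_conjTranspose, Matrix.mul_apply]
  refine Finset.sum_eq_zero fun i _ => ?_
  by_cases hi : regS L M Ω₀ k i
  · rw [Matrix.conjTranspose_apply, J0pcT_vanish₂ L M Ω₀ k z i hz hi, star_zero, mul_zero]
  · rw [J0pcT_vanish₁ L M Ω₀ k y i hy hi, zero_mul]

/-- `1 − Π₀` does not couple the complement to the region (right form). [folklore] -/
theorem one_sub_Pi0_vanish₂ : ∀ (y z : Tor (fine (lev L (k + 1)) M)),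
    ¬ regS L M Ω₀ (k + 1) y → regS L M Ω₀ (k + 1) z → (1 - Pi0T L M k) y z = 0 := by
  intro y z hy hz
  have h := one_sub_Pi0_vanish₁ L M Ω₀ k z y hz hy
  have hH : (1 - Pi0T L M k)ᴴ = 1 - Pi0T L M k := by
    rw [Matrix.conjTranspose_sub, Matrix.conjTranspose_one, Pi0T_conjTranspose]
  rw [← hH, Matrix.conjTranspose_apply, h, star_zero]

/-- the ZERO-EXTENDED DIRICHLET SOLUTION OPERATOR `X = selᴴ·G′(Ω)·sel` on the whole fine torus. [folklore] -/
def extGs : Matrix (Tor (fine (lev L (k + 1)) M)) (Tor (fine (lev L (k + 1)) M)) ℂ :=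
  (sel (regS L M Ω₀ (k + 1)))ᴴ * (DsR L M a' Ω₀ (k + 1))⁻¹ * sel (regS L M Ω₀ (k + 1))

/-- its action IS road P2's zero-extended Dirichlet solution: restrict, apply `G′(Ω)`, extend by zero. [folklore] -/
theorem extGs_mulVec (y : Tor (fine (lev L (k + 1)) M) → ℂ) :
    extGs L M a' Ω₀ k *ᵥ y = solExt (lev L (k + 1)) M a' (regS L M Ω₀ (k + 1)) (fun z : sidx L M Ω₀ (k + 1) => y z) := by
  set p := regS L M Ω₀ (k + 1) with hp
  have h1 : sel p *ᵥ y = fun z : sidx L M Ω₀ (k + 1) => y z := by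
    funext z
    simp only [Matrix.mulVec, dotProduct, sel, ite_mul, one_mul, zero_mul, Finset.sum_ite_eq, Finset.mem_univ, if_true]
  have h2 : ∀ w : sidx L M Ω₀ (k + 1) → ℂ, (sel p)ᴴ *ᵥ w = ext p w := by
    intro w
    funext i
    simp only [Matrix.mulVec, dotProduct, Matrix.conjTranspose_apply, sel, apply_ite star, star_one, star_zero, ite_mul,
      one_mul, zero_mul, ext]
    by_cases hi : p i
    · rw [dif_pos hi, Finset.sum_eq_single ⟨i, hi⟩]
      · simp
      · intro b _ hb
        rw [if_neg]
        intro h; exact hb (Subtype.ext h)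
      · intro h; exact absurd (Finset.mem_univ _) h
    · rw [dif_neg hi]
      refine Finset.sum_eq_zero fun b _ => ?_
      rw [if_neg]
      intro h; exact hi (h ▸ b.2)
  rw [extGs, ← Matrix.mulVec_mulVec, ← Matrix.mulVec_mulVec, h1, h2]
  rfl

/-- **THE GRADIENT BOUND**: `‖∂_ν · extGs‖ ≤ √(γ′⁻¹)` — lattice gradients of the zero-extended Dirichlet solution operator, through
the coercive form (road P2's `nsq_sdiff_solExt_le`). [folklore] -/
theorem opNorm_sdiff_mul_extGs_le (ha' : 0 < a') (ν : Fin d) :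
    ‖sdiff (fine (lev L (k + 1)) M) ((lev L (k + 1) : ℕ) : ℂ) ν * extGs L M a' Ω₀ k‖ ≤ Real.sqrt ((gammaPs d a')⁻¹) := by
  refine opNorm_le_of_nsq_le_rect _ (Real.sqrt_nonneg _) fun y => ?_
  rw [Real.sq_sqrt (inv_nonneg.mpr (gammaPs_pos (d := d) (a' := a')).1.le), ← Matrix.mulVec_mulVec, extGs_mulVec]
  refine (nsq_sdiff_solExt_le (lev L (k + 1)) M a' (regS L M Ω₀ (k + 1)) ha' _ ν).trans
    (mul_le_mul_of_nonneg_left ?_ (inv_nonneg.mpr (gammaPs_pos (d := d) (a' := a')).1.le))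
  unfold nsq
  rw [← Fintype.sum_subtype_add_sum_subtype (regS L M Ω₀ (k + 1)) (fun i => ‖y i‖ ^ 2)]
  exact le_add_of_nonneg_right (Finset.sum_nonneg fun _ _ => by positivity)

/-- hence the 0-form block Poincaré inequality: `‖(1 − Π₀)·extGs‖ ≤ 2d√(γ′⁻¹)·L^{−k}` (`d ≥ 1`). [folklore] -/
theorem opNorm_one_sub_Pi0_mul_extGs_le (hd : 0 < d) (ha' : 0 < a') :
    ‖(1 - Pi0T L M k) * extGs L M a' Ω₀ k‖ ≤ 2 * d * Real.sqrt ((gammaPs d a')⁻¹) * ((L : ℝ)⁻¹) ^ k := by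
  have hc : (((lev L (k + 1) : ℕ) : ℂ)) ≠ 0 := by exact_mod_cast (NeZero.ne (lev L (k + 1)))
  have hδ : ∀ ν, ‖(shiftS (fine (lev L (k + 1)) M) ν - 1) * extGs L M a' Ω₀ k‖
      ≤ Real.sqrt ((gammaPs d a')⁻¹) / ‖(((lev L (k + 1) : ℕ) : ℂ))‖ :=
    fun ν => opNorm_shiftS_sub_one_mul_le _ hc ν (opNorm_sdiff_mul_extGs_le L M a' Ω₀ k ha' ν)
  have hn : ‖(((lev L (k + 1) : ℕ) : ℂ))‖ = (L : ℝ) ^ (k + 1) := by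
    rw [Complex.norm_natCast, cast_lev']
  rw [hn] at hδ
  have hδ0 : 0 ≤ Real.sqrt ((gammaPs d a')⁻¹) / (L : ℝ) ^ (k + 1) := div_nonneg (Real.sqrt_nonneg _) (pow_nonneg (Nat.cast_nonneg L) _)
  have h : ‖(1 - Pi0T L M k) * extGs L M a' Ω₀ k‖ ≤ 2 * (d * L * (Real.sqrt ((gammaPs d a')⁻¹) / (L : ℝ) ^ (k + 1))) :=
    opNorm_one_sub_Pi0_mul_le (lev L k) L M hd (extGs L M a' Ω₀ k) hδ0 (fun ν => by exact hδ ν)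
  refine h.trans (le_of_eq ?_)
  have hL : (L : ℝ) ≠ 0 := by exact_mod_cast NeZero.ne L
  rw [inv_pow, pow_succ]
  field_simp

/-- **THE COMPLEMENT LAW ON THE REGION**: `‖G′^{(k+1)}(Ω)·(1 − J_kJ_kᴴ)_{Ω′Ω′}‖ ≤ 2d√(γ′⁻¹)·L^{−k}` (`d ≥ 1`) — the scalar Dirichlet Green
function is small off the block-constant fields, at the rate of the block size, uniformly in the region.
[cite: Balaban1985BackgroundPropagators, p.394 (3.24) (shape); King1986, (2.10) p.653] [folklore] -/
theorem complement_le_S (hd : 0 < d) (ha' : 0 < a') :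
    ‖(DsR L M a' Ω₀ (k + 1))⁻¹ * (1 - JsR L M Ω₀ k * (JsR L M Ω₀ k)ᴴ)‖
      ≤ 2 * d * Real.sqrt ((gammaPs d a')⁻¹) * ((L : ℝ)⁻¹) ^ k := by
  set p := regS L M Ω₀ (k + 1) with hp
  set G := (DsR L M a' Ω₀ (k + 1))⁻¹ with hG
  set Y := (1 - Pi0T L M k).toBlock p p with hY
  have hJJ : 1 - JsR L M Ω₀ k * (JsR L M Ω₀ k)ᴴ = Y := by
    rw [JsR_mul_conjTranspose, hY, toBlock_sub, toBlock_one]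
  rw [hJJ]
  -- both factors are Hermitian, so `‖G·Y‖ = ‖Y·G‖`
  have hGh : Gᴴ = G := (DsR_isHermitian L M a' Ω₀ (k + 1)).inv
  have hPi : (1 - Pi0T L M k)ᴴ = 1 - Pi0T L M k := by
    rw [Matrix.conjTranspose_sub, Matrix.conjTranspose_one, Pi0T_conjTranspose]
  have hYh : Yᴴ = Y := by rw [hY, toBlock_conjTranspose, hPi]
  have e1 : ‖G * Y‖ = ‖Y * G‖ := by
    rw [← Matrix.l2_opNorm_conjTranspose (G * Y), Matrix.conjTranspose_mul, hGh, hYh]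
  rw [e1]
  -- `Y·G = sel·((1 − Π₀)·extGs)·selᴴ`
  have e2 : Y * G = sel p * ((1 - Pi0T L M k) * extGs L M a' Ω₀ k) * (sel p)ᴴ := by
    have hvan : (1 - Pi0T L M k) * (sel p)ᴴ = (sel p)ᴴ * Y := by
      ext i b
      rw [mul_sel_conjTranspose_apply, Matrix.mul_apply]
      by_cases hi : p i
      · rw [Finset.sum_eq_single ⟨i, hi⟩]
        · simp [sel, hY, Matrix.toBlock_apply]
        · intro c _ hc
          have : (sel p)ᴴ i c = 0 := by
            rw [Matrix.conjTranspose_apply]; simp only [sel]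
            rw [if_neg, star_zero]; intro h; exact hc (Subtype.ext h)
          rw [this, zero_mul]
        · intro h; exact absurd (Finset.mem_univ _) h
      · have h0 : (1 - Pi0T L M k) i b = 0 := one_sub_Pi0_vanish₂ L M Ω₀ k i b hi b.2
        rw [h0]
        symm
        refine Finset.sum_eq_zero fun c _ => ?_
        have : (sel p)ᴴ i c = 0 := by
          rw [Matrix.conjTranspose_apply]; simp only [sel]
          rw [if_neg, star_zero]; intro h; exact hi (h ▸ c.2)
        rw [this, zero_mul]
    show Y * G = sel p * ((1 - Pi0T L M k) * ((sel p)ᴴ * G * sel p)) * (sel p)ᴴ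
    calc Y * G = Y * G * (sel p * (sel p)ᴴ) := by rw [sel_mul_sel_conjTranspose, Matrix.mul_one]
      _ = ((sel p * (sel p)ᴴ) * Y) * G * (sel p * (sel p)ᴴ) := by rw [sel_mul_sel_conjTranspose, Matrix.one_mul]
      _ = sel p * (((sel p)ᴴ * Y) * G * sel p) * (sel p)ᴴ := by simp only [Matrix.mul_assoc]
      _ = sel p * (((1 - Pi0T L M k) * (sel p)ᴴ) * G * sel p) * (sel p)ᴴ := by rw [hvan]
      _ = sel p * ((1 - Pi0T L M k) * ((sel p)ᴴ * G * sel p)) * (sel p)ᴴ := by simp only [Matrix.mul_assoc]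
  rw [e2]
  calc ‖sel p * ((1 - Pi0T L M k) * extGs L M a' Ω₀ k) * (sel p)ᴴ‖
      ≤ ‖sel p * ((1 - Pi0T L M k) * extGs L M a' Ω₀ k)‖ * ‖(sel p)ᴴ‖ := Matrix.l2_opNorm_mul _ _
    _ ≤ ‖sel p‖ * ‖(1 - Pi0T L M k) * extGs L M a' Ω₀ k‖ * ‖(sel p)ᴴ‖ :=
        mul_le_mul_of_nonneg_right (Matrix.l2_opNorm_mul _ _) (norm_nonneg _)
    _ ≤ 1 * (2 * d * Real.sqrt ((gammaPs d a')⁻¹) * ((L : ℝ)⁻¹) ^ k) * 1 := by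
        rw [Matrix.l2_opNorm_conjTranspose]
        have hs := opNorm_sel_le p
        have hb := opNorm_one_sub_Pi0_mul_extGs_le L M a' Ω₀ k hd ha'
        have h0 : 0 ≤ 2 * d * Real.sqrt ((gammaPs d a')⁻¹) * ((L : ℝ)⁻¹) ^ k := (norm_nonneg _).trans hb
        exact mul_le_mul (mul_le_mul hs hb (norm_nonneg _) zero_le_one) hs (norm_nonneg _) (by rw [one_mul]; exact h0)
    _ = _ := by ring

end Complement

/-! ## §4 The END: the scalar Dirichlet free tower modulo the injected law, and its consequences at a general rate -/

/-- **THE Ω-RESTRICTED SCALAR FREE TOWER LAWS MODULO THE INJECTED LAW** (`U = 1`, `d ≥ 1`, `a′ > 0`): every field of `FreeTowerLaws` for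
the compressed scalar tower is a THEOREM (invertibility, `‖QsR‖² ≤ L^{−d}`, `‖JsR‖ ≤ 1`, exact pairing with `F = 0`, complement law
`2d√(γ′⁻¹)·L^{−k}`) except the injected two-level law, displayed as `hinjS` — road P2's two-level target at `(N, R) = (L^k, L)`.
[cite: Balaban1985BackgroundPropagators, p.394 (3.24), Thm 3.1 (3.42) p.397 (η-uniform kind only)] [folklore] -/
theorem freeTowerLaws_dirichletScalar_of_injected (hd : 0 < d) (ha' : 0 < a') {e₁ : ℕ → ℝ}
    (hinjS : ∀ k, ‖(DsR L M a' Ω₀ (k + 1))⁻¹ * JsR L M Ω₀ k - JsR L M Ω₀ k * (DsR L M a' Ω₀ k)⁻¹‖ ≤ e₁ k) :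
    FreeTowerLaws (DsR L M a' Ω₀) (QsR L M Ω₀) (JsR L M Ω₀) (fun _ => 0) ((L : ℝ) ^ d)
      (fun k => 2 * d * Real.sqrt ((gammaPs d a')⁻¹) * ((L : ℝ)⁻¹) ^ k) e₁ (fun _ => 0) where
  isUnit_det := isUnit_det_DsR L M a' Ω₀ ha'
  opNorm_A_sq_le := opNorm_QsR_sq_le L M Ω₀
  opNorm_J_le := opNorm_JsR_le L M Ω₀
  A_mul_J := sqrt_smul_QsR_mul_JsR L M Ω₀
  opNorm_F_mul_inv_le := fun k => by rw [Matrix.zero_mul, norm_zero]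
  opNorm_inv_mul_F_le := fun k => by rw [Matrix.conjTranspose_zero, Matrix.mul_zero, norm_zero]
  complement_le := fun k => complement_le_S L M a' Ω₀ k hd ha'
  injected_le := hinjS

/-- **KERNEL CHECK OF THE INTERFACE**: the binder `hinjS` at level `k` IS road P2's two-level quantity for the region `Ω_k = regS Ω₀ k` at
`(N, R) = (n_k, L)` — `DsR (k+1)` unfolds to `DOm (L·n_k) M a′ (refineR n_k L M Ω_k)` and `JsR k` to `JOm n_k L M Ω_k` DEFINITIONALLY, so a
two-level bound stated on `DirichletBoxCompression`'s carriers is consumed by `exact`. -/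
example (k : ℕ) {e : ℝ}
    (h : ‖(DOm (L * lev L k) M a' (refineR (lev L k) L M (regS L M Ω₀ k)))⁻¹ * JOm (lev L k) L M (regS L M Ω₀ k)
        - JOm (lev L k) L M (regS L M Ω₀ k) * (DOm (lev L k) M a' (regS L M Ω₀ k))⁻¹‖ ≤ e) :
    ‖(DsR L M a' Ω₀ (k + 1))⁻¹ * JsR L M Ω₀ k - JsR L M Ω₀ k * (DsR L M a' Ω₀ k)⁻¹‖ ≤ e := h

omit [NeZero L] hM [DecidablePred Ω₀] in
/-- the complement constant is nonnegative. [folklore] -/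
theorem complementConst_nonneg : 0 ≤ 2 * d * Real.sqrt ((gammaPs d a')⁻¹) := by positivity

/-- **THE Ω-RESTRICTED UNIT-LATTICE SCALAR FREE COVARIANCES CONVERGE, MODULO THE INJECTED LAW, AT ANY GEOMETRIC RATE `θ ∈ [L⁻¹, 1)`**:
`hinjS` with majorant `C₁θ^k` ⟹ `TowerLimitRate (QsR Ω₀) L^d (k ↦ G′^{(k)}(Ω)) (Cpert 0 (2d√(γ′⁻¹)) C₁ 0 0 0) θ` — the Dirichlet analogue of
King's scalar free limit, displayed at a general rate (row B8; the numerical census sees `θ = L⁻¹`).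
[cite: King1986, Lemma 4.5 (4.38) p.674 (shape)] [folklore] -/
theorem towerLimitRate_dirichletScalar_of_injected (hd : 0 < d) (ha' : 0 < a') {θ C₁ : ℝ} (hθ : ((L : ℝ)⁻¹) ≤ θ) (hθ1 : θ < 1)
    (hinjS : ∀ k, ‖(DsR L M a' Ω₀ (k + 1))⁻¹ * JsR L M Ω₀ k - JsR L M Ω₀ k * (DsR L M a' Ω₀ k)⁻¹‖ ≤ C₁ * θ ^ k) :
    TowerLimitRate (QsR L M Ω₀) ((L : ℝ) ^ d) (fun k => (DsR L M a' Ω₀ k)⁻¹)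
      (Cpert 0 (2 * d * Real.sqrt ((gammaPs d a')⁻¹)) C₁ 0 0 0) θ := by
  have hr : (0 : ℝ) < (L : ℝ) ^ d := pow_pos (by exact_mod_cast Nat.pos_of_ne_zero (NeZero.ne L)) d
  have hC₀ := complementConst_nonneg (d := d) a'
  have ht : ‖(0 : ℂ)‖ * 0 < 1 := by rw [norm_zero, zero_mul]; exact one_pos
  have h := towerLimitRate_perturbed hr (freeTowerLaws_dirichletScalar_of_injected L M a' Ω₀ hd ha' hinjS)
    (perturbationLaws_zero (D := DsR L M a' Ω₀) (J := JsR L M Ω₀)) hθ1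
    (fun k => mul_le_mul_of_nonneg_left (pow_le_pow_left₀ (inv_nonneg.mpr (Nat.cast_nonneg L)) hθ k) hC₀)
    (fun k => le_rfl) (fun k => by rw [zero_mul]) (fun k => by rw [zero_mul]) ht
  simp only [zero_smul, add_zero] at h
  exact h

/-- **THE RESOLVENT ROUTE RUNS VERBATIM OVER THE SCALAR REGION CARRIERS**: for every compressed perturbation family `P` with
`PerturbationLaws (DsR Ω₀) P (JsR Ω₀) κ (k ↦ C₂θ^k)` and every `‖t‖κ < 1`, the Ω-restricted perturbed scalar covariances converge at rate
`θ` (modulo `hinjS`) — how the scalar background rows (B4.e) would be re-run on a region once the injected law is supplied. [folklore] -/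
theorem towerLimitRate_dirichletScalar_perturbed (hd : 0 < d) (ha' : 0 < a') {θ C₁ : ℝ} (hθ : ((L : ℝ)⁻¹) ≤ θ) (hθ1 : θ < 1)
    (hinjS : ∀ k, ‖(DsR L M a' Ω₀ (k + 1))⁻¹ * JsR L M Ω₀ k - JsR L M Ω₀ k * (DsR L M a' Ω₀ k)⁻¹‖ ≤ C₁ * θ ^ k)
    {P : (k : ℕ) → Matrix (sidx L M Ω₀ k) (sidx L M Ω₀ k) ℂ} {κ C₂ : ℝ}
    (hpert : PerturbationLaws (DsR L M a' Ω₀) P (JsR L M Ω₀) κ (fun k => C₂ * θ ^ k)) {t : ℂ} (ht : ‖t‖ * κ < 1) :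
    TowerLimitRate (QsR L M Ω₀) ((L : ℝ) ^ d) (fun k => (DsR L M a' Ω₀ k + t • P k)⁻¹)
      (Cpert κ (2 * d * Real.sqrt ((gammaPs d a')⁻¹)) C₁ C₂ 0 t) θ := by
  have hr : (0 : ℝ) < (L : ℝ) ^ d := pow_pos (by exact_mod_cast Nat.pos_of_ne_zero (NeZero.ne L)) d
  have hC₀ := complementConst_nonneg (d := d) a'
  exact towerLimitRate_perturbed hr (freeTowerLaws_dirichletScalar_of_injected L M a' Ω₀ hd ha' hinjS) hpert hθ1
    (fun k => mul_le_mul_of_nonneg_left (pow_le_pow_left₀ (inv_nonneg.mpr (Nat.cast_nonneg L)) hθ k) hC₀)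
    (fun k => le_rfl) (fun k => le_rfl) (fun k => by rw [zero_mul]) ht

end Summit.QuantumFields.BalabanUV.T4Continuum.DirichletScalarTower

end
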